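import Mathlib
import Summits.Ventures.PercRepro2.Defs
import Summits.Ventures.PercRepro2.Independence
import Summits.Ventures.PercRepro2.Harris
import Summits.Ventures.PercRepro2.Graph
import Summits.Ventures.PercRepro2.Exploration
import Summits.Ventures.PercRepro2.Events
import Summits.Ventures.PercRepro2.FourFunctions
import Summits.Ventures.PercRepro2.Induced
import Summits.Ventures.PercRepro2.Frontier
import Summits.Ventures.PercRepro2.ObsIndependence
import Summits.Ventures.PercRepro2.BHK
import Summits.Ventures.PercRepro2.BHKEvents
import Summits.Ventures.PercRepro2.OrderPreservation
import Summits.Ventures.PercRepro2.OrderPreservationDual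
import Summits.Ventures.PercRepro2.VdBKahn
import Summits.Ventures.PercRepro2.BHKAvoid
import Summits.Ventures.PercRepro2.R2PrimeThreeReduction
import Summits.Ventures.PercRepro2.YBridge
import Summits.Ventures.PercRepro2.Yu1Functionals
import Summits.Ventures.PercRepro2.Yu1Events

/-!
# (Yu1) is a theorem (blind cell PercRepro2, typer-1; `proofs/LEAD-PROOFSHAPES.md` §8.9 ADDENDUM 10 (10d))

Light-first exploration of `S = C(a₁)` (`a₁` light, `a₂` heavy, `a₃` a third root) on
`R = {a₂ ∉ S, a₃ ∉ S}`, with the functionals `u`, `β`, `q` of `Yu1Functionals`: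

* tower identities (`prob_clusterIn_inter_avoid_eq_expect` + the event identities of `Yu1Events`):
  `T_{l→h} = E[1_o q; R]`, `P(PD) = E[u; R]`, `P(PD, o ∈ C₁) = E[1_o u; R]`, `N_h = E[β; R]`,
  `r_b = E[1_b (1 − u); R]`, `P(b ∈ C₁, R) = E[1_b; R]`, and `M₂ + Δ_T = N_h − r_b`;
* the four steps: (1) Harris in `G ∖ S`: `q ≤ u β` (`Yu1.q_le`); (2) BHK 1.3 (`bhk_induced`,
  `s = a₁`, `X = {a₂, a₃}`, `f = 1_o u` increasing, `g = 1 − β` increasing) — `bhk_step2`;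
  (3) BHK 1.3 again (`f = 1_b`, `g = u`) — `bhk_step3`; (4) R10d on `R` (`order_on_R`):
  `E[1_b; R] ≤ E[β; R]` — the only place the labelling `P(b ↔ a₁) ≤ P(b ↔ a₂)` enters.

Result: **(Yu1)** `T_{l→h} · P(PD) ≤ P(PD, o ∈ C₁) · (M₂ + Δ_T)` (`yu1_cleared`), i.e.
`T_{l→h} ≤ g_l · (M₂ + Δ_T)` with `g_l = P(o ∈ C₁ | PD)` (`yu1_theorem`, `P(PD) > 0`).
The `P(R) = 0` case is handled separately (every expectation against `1_R` vanishes).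
-/

namespace Summit.Ventures.PercRepro2

open UnionCluster

section Yu1Main

open Yu1

variable {V : Type*} {E : Type*} [Fintype E] [DecidableEq E] [Fintype V] [DecidableEq V]
  {R : Type*} [Field R] [LinearOrder R] [IsStrictOrderedRing R]

omit [LinearOrder R] [IsStrictOrderedRing R] in
/-- Tower identity: `T_{l→h} = E[1_o(C₁) q(C₁); R]`. -/
lemma tower_T (p : E → R) (ends : E → Sym2 V) (o a₁ a₂ a₃ b : V) :
    prob p (PDEvent ends a₁ a₂ a₃ ∩ connEvent ends a₁ o ∩ connEvent ends a₂ b) =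
      expect p (fun ω => ind o (cluster ends ω a₁) * q p ends a₂ a₃ b (cluster ends ω a₁) *
        (avoidAll ends a₁ {a₂, a₃}).indicator 1 ω) := by
  rw [← Tlh_event_eq, prob_clusterIn_inter_avoid_eq_expect p ends a₁ a₂ (X := {a₂, a₃})
    (Finset.mem_insert_self a₂ {a₃})]
  rfl

omit [LinearOrder R] [IsStrictOrderedRing R] in
/-- Tower identity: `P(PD) = E[u(C₁); R]`. -/
lemma tower_PD (p : E → R) (ends : E → Sym2 V) (a₁ a₂ a₃ : V) :
    prob p (PDEvent ends a₁ a₂ a₃) =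
      expect p (fun ω => u p ends a₂ a₃ (cluster ends ω a₁) *
        (avoidAll ends a₁ {a₂, a₃}).indicator 1 ω) := by
  rw [← PD_event_eq, prob_clusterIn_inter_avoid_eq_expect p ends a₁ a₂ (X := {a₂, a₃})
    (Finset.mem_insert_self a₂ {a₃})]
  unfold u
  simp only [Set.indicator_univ, Pi.one_apply, one_mul]

omit [LinearOrder R] [IsStrictOrderedRing R] in
/-- Tower identity: `P(PD, o ∈ C₁) = E[1_o(C₁) u(C₁); R]`. -/
lemma tower_PDo (p : E → R) (ends : E → Sym2 V) (o a₁ a₂ a₃ : V) :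
    prob p (PDEvent ends a₁ a₂ a₃ ∩ connEvent ends a₁ o) =
      expect p (fun ω => ind o (cluster ends ω a₁) * u p ends a₂ a₃ (cluster ends ω a₁) *
        (avoidAll ends a₁ {a₂, a₃}).indicator 1 ω) := by
  rw [← PDo_event_eq, prob_clusterIn_inter_avoid_eq_expect p ends a₁ a₂ (X := {a₂, a₃})
    (Finset.mem_insert_self a₂ {a₃})]
  rfl

omit [LinearOrder R] [IsStrictOrderedRing R] in
/-- Tower identity: `N_h = P(b ∈ C₂, R) = E[β(C₁); R]`. -/
lemma tower_N (p : E → R) (ends : E → Sym2 V) (a₁ a₂ a₃ b : V) :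
    prob p (connEvent ends a₂ b ∩ avoidAll ends a₁ {a₂, a₃}) =
      expect p (fun ω => beta p ends a₂ b (cluster ends ω a₁) *
        (avoidAll ends a₁ {a₂, a₃}).indicator 1 ω) := by
  rw [← Nh_event_eq ends a₁ a₂ a₃ b, prob_clusterIn_inter_avoid_eq_expect p ends a₁ a₂
    (X := {a₂, a₃}) (Finset.mem_insert_self a₂ {a₃})]
  unfold beta
  simp only [Set.indicator_univ, Pi.one_apply, one_mul]

omit [LinearOrder R] [IsStrictOrderedRing R] in
/-- Tower identity: `r_b = P(b ∈ C₁, T) = E[1_b(C₁) (1 − u(C₁)); R]`. -/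
lemma tower_r (p : E → R) (ends : E → Sym2 V) (a₁ a₂ a₃ b : V) :
    prob p (connEvent ends a₁ b ∩ TEvent ends a₁ a₂ a₃) =
      expect p (fun ω => ind b (cluster ends ω a₁) * (1 - u p ends a₂ a₃ (cluster ends ω a₁)) *
        (avoidAll ends a₁ {a₂, a₃}).indicator 1 ω) := by
  rw [← rb_event_eq, prob_clusterIn_inter_avoid_eq_expect p ends a₁ a₂ (X := {a₂, a₃})
    (Finset.mem_insert_self a₂ {a₃})]
  simp only [one_sub_u]
  rfl

omit [Fintype V] [LinearOrder R] [IsStrictOrderedRing R] in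
/-- `P(b ∈ C₁, R) = E[1_b(C₁); R]`. -/
lemma tower_b (p : E → R) (ends : E → Sym2 V) (a₁ a₂ a₃ b : V) :
    prob p (connEvent ends a₁ b ∩ avoidAll ends a₁ {a₂, a₃}) =
      expect p (fun ω => ind b (cluster ends ω a₁) * (avoidAll ends a₁ {a₂, a₃}).indicator 1 ω) := by
  rw [prob_eq_expect_indicator]
  unfold expect
  refine Finset.sum_congr rfl fun ω _ => ?_
  congr 1
  rw [indicator_inter_one]
  rfl

/-- **Step (2)**: BHK 1.3 with `f = 1_o u` (increasing) and `g = 1 − β` (increasing), cleared: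
`E[1_o u β; R] · P(R) ≤ E[1_o u; R] · E[β; R]`. -/
lemma bhk_step2 (p : E → R) (hp : IsProbVec p) (ends : E → Sym2 V) (o a₁ a₂ a₃ b : V) :
    expect p (fun ω => ind o (cluster ends ω a₁) * u p ends a₂ a₃ (cluster ends ω a₁) *
        beta p ends a₂ b (cluster ends ω a₁) * (avoidAll ends a₁ {a₂, a₃}).indicator 1 ω) *
      prob p (avoidAll ends a₁ {a₂, a₃}) ≤
    expect p (fun ω => ind o (cluster ends ω a₁) * u p ends a₂ a₃ (cluster ends ω a₁) *
        (avoidAll ends a₁ {a₂, a₃}).indicator 1 ω) *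
      expect p (fun ω => beta p ends a₂ b (cluster ends ω a₁) *
        (avoidAll ends a₁ {a₂, a₃}).indicator 1 ω) := by
  have h := bhk_induced p hp ends a₁ (F₁ := fun W => ind o W * u p ends a₂ a₃ W)
    (F₂ := fun W => 1 - beta p ends a₂ b W)
    (fun W W' hW => mul_le_mul (ind_mono o hW) (u_mono p hp ends a₂ a₃ hW)
      (u_nonneg p hp ends a₂ a₃ W) (ind_nonneg o W'))
    (fun W W' hW => sub_le_sub_left (beta_anti p hp ends a₂ b hW) 1)
    (fun W => mul_nonneg (ind_nonneg o W) (u_nonneg p hp ends a₂ a₃ W))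
    (fun W => sub_nonneg.2 (beta_le_one p hp ends a₂ b W))
    Finset.univ {a₂, a₃} {a₂, a₃} (Finset.subset_univ _) (Finset.subset_univ _)
  simp only [REvent_univ, Finset.inter_self, Finset.union_self, expect_clusterObs_univ,
    Pi.mul_apply] at h
  have e1 : expect p (fun ω => (1 - beta p ends a₂ b (cluster ends ω a₁)) *
      (avoidAll ends a₁ {a₂, a₃}).indicator 1 ω) =
      prob p (avoidAll ends a₁ {a₂, a₃}) - expect p (fun ω => beta p ends a₂ b (cluster ends ω a₁) *
        (avoidAll ends a₁ {a₂, a₃}).indicator 1 ω) := by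
    rw [prob_eq_expect_indicator, ← expect_sub]
    congr 1
    funext ω
    simp only [Pi.sub_apply]
    ring
  have e2 : expect p (fun ω => ind o (cluster ends ω a₁) * u p ends a₂ a₃ (cluster ends ω a₁) *
      (1 - beta p ends a₂ b (cluster ends ω a₁)) * (avoidAll ends a₁ {a₂, a₃}).indicator 1 ω) =
      expect p (fun ω => ind o (cluster ends ω a₁) * u p ends a₂ a₃ (cluster ends ω a₁) *
        (avoidAll ends a₁ {a₂, a₃}).indicator 1 ω) -
      expect p (fun ω => ind o (cluster ends ω a₁) * u p ends a₂ a₃ (cluster ends ω a₁) *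
        beta p ends a₂ b (cluster ends ω a₁) * (avoidAll ends a₁ {a₂, a₃}).indicator 1 ω) := by
    rw [← expect_sub]
    congr 1
    funext ω
    simp only [Pi.sub_apply]
    ring
  rw [e1, e2] at h
  linarith [h]

/-- **Step (3)**: BHK 1.3 with `f = 1_b` and `g = u` (both increasing):
`E[1_b; R] · E[u; R] ≤ E[1_b u; R] · P(R)`. -/
lemma bhk_step3 (p : E → R) (hp : IsProbVec p) (ends : E → Sym2 V) (a₁ a₂ a₃ b : V) :
    expect p (fun ω => ind b (cluster ends ω a₁) * (avoidAll ends a₁ {a₂, a₃}).indicator 1 ω) *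
      expect p (fun ω => u p ends a₂ a₃ (cluster ends ω a₁) *
        (avoidAll ends a₁ {a₂, a₃}).indicator 1 ω) ≤
    expect p (fun ω => ind b (cluster ends ω a₁) * u p ends a₂ a₃ (cluster ends ω a₁) *
        (avoidAll ends a₁ {a₂, a₃}).indicator 1 ω) *
      prob p (avoidAll ends a₁ {a₂, a₃}) := by
  have h := bhk_induced p hp ends a₁ (F₁ := (ind b : Set V → R)) (F₂ := u p ends a₂ a₃)
    (ind_mono b) (u_mono p hp ends a₂ a₃) (ind_nonneg b) (u_nonneg p hp ends a₂ a₃)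
    Finset.univ {a₂, a₃} {a₂, a₃} (Finset.subset_univ _) (Finset.subset_univ _)
  simpa only [REvent_univ, Finset.inter_self, Finset.union_self, expect_clusterObs_univ,
    Pi.mul_apply] using h

omit [Fintype E] [DecidableEq E] [Fintype V] [DecidableEq V] [LinearOrder R]
  [IsStrictOrderedRing R] in
/-- **Slack identity of the (10d) proof** (every term an expectation against `1_R`): with
`T = E[1_o q]`, `U = E[u]`, `A = E[1_o u]`, `B = E[β]`, `Bb = E[1_b]`, `BbU = E[1_b u]`,
`ABu = E[1_o u β]`, `PR = P(R)` and `r_b = Bb − BbU`,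
`(A (B − r_b) − T U) · PR = (ABu − T) U PR  [Harris]  + (A B − ABu PR) U  [BHK 1.3, f = 1_o u, g = 1 − β]
  + A (B − Bb)(PR − U)  [R10d: the only term needing the labelling]  + A (BbU PR − Bb U)  [BHK 1.3, f = 1_b, g = u]`. -/
lemma slack_identity {T ABu A B Bb BbU Uu PR Rb : R} (eRb : Rb = Bb - BbU) :
    (A * (B - Rb) - T * Uu) * PR =
      (ABu - T) * Uu * PR + (A * B - ABu * PR) * Uu + A * (B - Bb) * (PR - Uu) +
        A * (BbU * PR - Bb * Uu) := by
  rw [eRb]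
  ring

/-- **(Yu1), cleared form**: `T_{l→h} · P(PD) ≤ P(PD, o ∈ C₁) · (M₂ + Δ_T)` under the labelling
`P(b ↔ a₁) ≤ P(b ↔ a₂)` (`a₁` light, `a₂` heavy). -/
theorem yu1_cleared (p : E → R) (hp : IsProbVec p) (ends : E → Sym2 V) {o a₁ a₂ a₃ b : V}
    (hord : prob p (connEvent ends a₁ b) ≤ prob p (connEvent ends a₂ b)) :
    prob p (PDEvent ends a₁ a₂ a₃ ∩ connEvent ends a₁ o ∩ connEvent ends a₂ b) *
        prob p (PDEvent ends a₁ a₂ a₃) ≤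
      prob p (PDEvent ends a₁ a₂ a₃ ∩ connEvent ends a₁ o) *
        (massM2 p ends a₁ a₂ a₃ b + deltaT p ends a₁ a₂ a₃ b) := by
  -- `M₂ + Δ_T = N_h − r_b`
  have hMΔ : massM2 p ends a₁ a₂ a₃ b + deltaT p ends a₁ a₂ a₃ b =
      prob p (connEvent ends a₂ b ∩ avoidAll ends a₁ {a₂, a₃}) -
        prob p (connEvent ends a₁ b ∩ TEvent ends a₁ a₂ a₃) := by
    rw [Nh_eq p ends a₁ a₂ a₃ b]
    unfold deltaT
    ring
  -- the order on `R`, in tower form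
  have s4 := order_on_R p hp ends (a₃ := a₃) hord
  rw [tower_b, tower_N] at s4
  rw [hMΔ, tower_T, tower_PD, tower_PDo, tower_N, tower_r]
  -- Harris pointwise: `E[1_o q; R] ≤ E[1_o u β; R]`
  have s1 : expect p (fun ω => ind o (cluster ends ω a₁) * q p ends a₂ a₃ b (cluster ends ω a₁) *
      (avoidAll ends a₁ {a₂, a₃}).indicator 1 ω) ≤
      expect p (fun ω => ind o (cluster ends ω a₁) * u p ends a₂ a₃ (cluster ends ω a₁) *
        beta p ends a₂ b (cluster ends ω a₁) * (avoidAll ends a₁ {a₂, a₃}).indicator 1 ω) := by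
    refine expect_mono hp fun ω => ?_
    have hind : 0 ≤ (avoidAll ends a₁ {a₂, a₃}).indicator (1 : Config E → R) ω :=
      Set.indicator_apply_nonneg fun _ => zero_le_one
    have h1 := mul_le_mul_of_nonneg_left (q_le p hp ends a₂ a₃ b (cluster ends ω a₁))
      (ind_nonneg o (cluster ends ω a₁))
    calc ind o (cluster ends ω a₁) * q p ends a₂ a₃ b (cluster ends ω a₁) *
          (avoidAll ends a₁ {a₂, a₃}).indicator 1 ω
        ≤ ind o (cluster ends ω a₁) * (u p ends a₂ a₃ (cluster ends ω a₁) *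
            beta p ends a₂ b (cluster ends ω a₁)) * (avoidAll ends a₁ {a₂, a₃}).indicator 1 ω :=
          mul_le_mul_of_nonneg_right h1 hind
      _ = _ := by ring
  have h2 := bhk_step2 p hp ends o a₁ a₂ a₃ b
  have h3 := bhk_step3 p hp ends a₁ a₂ a₃ b
  -- `r_b = E[1_b; R] − E[1_b u; R]`
  have eRb : expect p (fun ω => ind b (cluster ends ω a₁) *
      (1 - u p ends a₂ a₃ (cluster ends ω a₁)) * (avoidAll ends a₁ {a₂, a₃}).indicator 1 ω) =
      expect p (fun ω => ind b (cluster ends ω a₁) * (avoidAll ends a₁ {a₂, a₃}).indicator 1 ω) -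
      expect p (fun ω => ind b (cluster ends ω a₁) * u p ends a₂ a₃ (cluster ends ω a₁) *
        (avoidAll ends a₁ {a₂, a₃}).indicator 1 ω) := by
    rw [← expect_sub]
    congr 1
    funext ω
    simp only [Pi.sub_apply]
    ring
  -- nonnegativity and `E[u; R] ≤ P(R)`
  have hind : ∀ ω, 0 ≤ (avoidAll ends a₁ {a₂, a₃}).indicator (1 : Config E → R) ω :=
    fun _ => Set.indicator_apply_nonneg fun _ => zero_le_one
  have hA : 0 ≤ expect p (fun ω => ind o (cluster ends ω a₁) * u p ends a₂ a₃ (cluster ends ω a₁) *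
      (avoidAll ends a₁ {a₂, a₃}).indicator 1 ω) :=
    expect_nonneg hp fun ω => mul_nonneg (mul_nonneg (ind_nonneg o _) (u_nonneg p hp ends a₂ a₃ _))
      (hind ω)
  have hU : 0 ≤ expect p (fun ω => u p ends a₂ a₃ (cluster ends ω a₁) *
      (avoidAll ends a₁ {a₂, a₃}).indicator 1 ω) :=
    expect_nonneg hp fun ω => mul_nonneg (u_nonneg p hp ends a₂ a₃ _) (hind ω)
  have hPR : 0 ≤ prob p (avoidAll ends a₁ {a₂, a₃}) := prob_nonneg hp _
  have hUPR : expect p (fun ω => u p ends a₂ a₃ (cluster ends ω a₁) *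
      (avoidAll ends a₁ {a₂, a₃}).indicator 1 ω) ≤ prob p (avoidAll ends a₁ {a₂, a₃}) := by
    rw [prob_eq_expect_indicator]
    exact expect_mono hp fun ω => mul_le_of_le_one_left (hind ω) (u_le_one p hp ends a₂ a₃ _)
  have key := chain_alg s1 h2 h3 eRb s4 hA hU hPR hUPR
  rcases hPR.lt_or_eq with hpos | hzero
  · exact le_of_mul_le_mul_right key hpos
  · -- `P(R) = 0`: every expectation against `1_R` vanishes
    have hz : ∀ g : Config E → R,
        expect p (fun ω => g ω * (avoidAll ends a₁ {a₂, a₃}).indicator 1 ω) = 0 :=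
      fun g => expect_mul_indicator_eq_zero_of_null hp hzero.symm g
    simp only [hz, mul_zero, sub_zero, le_refl]

end Yu1Main

section Yu1Ratio

variable {V : Type*} {E : Type*} [Fintype E] [DecidableEq E] [Fintype V] [DecidableEq V]
  {R : Type*} [Field R] [LinearOrder R] [IsStrictOrderedRing R]

/-- **(Yu1)** (`proofs/LEAD-PROOFSHAPES.md` §8.9 ADDENDUM 10 (10d)): `T_{l→h} ≤ g_l · (M₂ + Δ_T)`
with `g_l = P(o ∈ C₁ | PD)`, ratio form (`P(PD) > 0`), under the labelling
`P(b ↔ a₁) ≤ P(b ↔ a₂)`. -/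
theorem yu1_theorem (p : E → R) (hp : IsProbVec p) (ends : E → Sym2 V) {o a₁ a₂ a₃ b : V}
    (hord : prob p (connEvent ends a₁ b) ≤ prob p (connEvent ends a₂ b))
    (hPD : 0 < prob p (PDEvent ends a₁ a₂ a₃)) :
    prob p (PDEvent ends a₁ a₂ a₃ ∩ connEvent ends a₁ o ∩ connEvent ends a₂ b) ≤
      prob p (PDEvent ends a₁ a₂ a₃ ∩ connEvent ends a₁ o) / prob p (PDEvent ends a₁ a₂ a₃) *
        (massM2 p ends a₁ a₂ a₃ b + deltaT p ends a₁ a₂ a₃ b) := by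
  have key := yu1_cleared p hp ends (o := o) (a₃ := a₃) hord
  rw [div_mul_eq_mul_div, le_div_iff₀ hPD]
  exact key

end Yu1Ratio

end Summit.Ventures.PercRepro2
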